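import Mathlib.Data.Real.Basic
import Mathlib.Data.Matrix.Basic
import Mathlib.Data.List.GetD
import Literature.Computation.Certificates.Data
import Summits.NavierStokesRegularity.TurbBounds.PieceAssembly
import HarnessLib

/-!
# List-level linear combinations of literal row matrices (tool; evaluator identities in time linear in the data)

Cell `pub-turb` / `turb-bounds`, v2 tooling (pub-turb-cert gen 7, prover-pub-turb-cert-g7-0). An EVALUATOR identity `B.A = den • Mel ε u v`
('the certified block IS the rule at its data') was checked by `decide +kernel` ENTRYWISE, the kernel recomputing every entry of the rule from
its literal piece matrices through positional `List.getD` lookups — 95 s per block at dim 62 (14 pieces), and ∝ n³ beyond. Here the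
right-hand side is ASSEMBLED as row lists in one pass per piece (`axpyRows c acc rows` = `acc + c·rows` row by row, ragged rows allowed —
trailing zeros may be dropped, extra entries/rows are ignored), and the meaning is proved once:
* `getD_axpyRow`, `getD_axpyRows` (entrywise semantics), `Shaped` (an `n × n` accumulator) and its preservation;
* `matrixOfRows_axpyRows` : `matrixOfRows n n (axpyRows c acc rows) = matrixOfRows n n acc + c • matrixOfRows n n rows` for a shaped `acc`;
* `lincomb n ps` (fold from shear's `PieceAssembly.zeroRows`, reused from the tree) and **`matrixOfRows_lincomb`** : `matrixOfRows n n (lincomb n ps) = combSum n ps = Σ c • matrixOfRows n n rows`.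
So a kernel `decide` on the LIST equality `B.A_rows = lincomb n ps` (linear cost) proves the matrix identity. No new trusted surface: list algebra.
HONEST FRAMING: rigorous bounds for the stated PDE and boundary conditions; no claim about physical turbulence beyond the bound.
-/

set_option linter.style.longLine false

namespace Summit.NavierStokesRegularity.TurbBounds.EvalRows

open Literature.Computation.Certificates
open Summit.NavierStokesRegularity.TurbBounds.PieceAssembly (zeroRows matrixOfRows_zeroRows)

/-- `axpyRow c as r = as + c·r` pointwise, to the length of `as` (a shorter `r` is padded by `0`, a longer one truncated). -/
def axpyRow (c : ℚ) : List ℚ → List ℚ → List ℚ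
  | a :: as, r :: rs => (a + c * r) :: axpyRow c as rs
  | a :: as, [] => a :: as
  | [], _ => []

/-- `axpyRow` keeps the accumulator's length. -/
theorem length_axpyRow (c : ℚ) : ∀ (as r : List ℚ), (axpyRow c as r).length = as.length
  | [], r => by cases r <;> rfl
  | a :: as, [] => rfl
  | a :: as, r :: rs => by simp [axpyRow, length_axpyRow c as rs]

/-- Entrywise meaning of `axpyRow` inside the accumulator. -/
theorem getD_axpyRow (c : ℚ) : ∀ (as r : List ℚ) (j : ℕ), j < as.length → (axpyRow c as r).getD j 0 = as.getD j 0 + c * r.getD j 0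
  | [], r, j, hj => by simp at hj
  | a :: as, [], j, _ => by cases j <;> simp [axpyRow]
  | a :: as, r :: rs, 0, _ => by simp [axpyRow]
  | a :: as, r :: rs, j + 1, hj => by
      simp only [axpyRow, List.getD_cons_succ]
      exact getD_axpyRow c as rs j (by simpa using hj)

/-- `axpyRows c acc rows = acc + c·rows` row by row, to the length of `acc`. -/
def axpyRows (c : ℚ) : List (List ℚ) → List (List ℚ) → List (List ℚ)
  | a :: as, r :: rs => axpyRow c a r :: axpyRows c as rs
  | a :: as, [] => a :: as
  | [], _ => []

/-- `axpyRows` keeps the number of rows. -/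
theorem length_axpyRows (c : ℚ) : ∀ (acc rows : List (List ℚ)), (axpyRows c acc rows).length = acc.length
  | [], rows => by cases rows <;> rfl
  | a :: as, [] => rfl
  | a :: as, r :: rs => by simp [axpyRows, length_axpyRows c as rs]

/-- Row `i` of `axpyRows` (an absent row of `rows` counts as `[]`, and `axpyRow c a [] = a`). -/
theorem getD_axpyRows (c : ℚ) : ∀ (acc rows : List (List ℚ)) (i : ℕ), i < acc.length →
    (axpyRows c acc rows).getD i [] = axpyRow c (acc.getD i []) (rows.getD i [])
  | [], rows, i, hi => by simp at hi
  | a :: as, [], i, hi => by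
      cases i with
      | zero => cases a <;> simp [axpyRows, axpyRow]
      | succ i =>
        simp only [axpyRows, List.getD_cons_succ, List.getD_nil]
        cases h : as.getD i [] <;> simp [axpyRow]
  | a :: as, r :: rs, 0, _ => by simp [axpyRows]
  | a :: as, r :: rs, i + 1, hi => by
      simp only [axpyRows, List.getD_cons_succ]
      exact getD_axpyRows c as rs i (by simpa using hi)

/-- A well-shaped accumulator: `n` rows, each of length `n`. -/
def Shaped (n : ℕ) (acc : List (List ℚ)) : Prop := acc.length = n ∧ ∀ i, i < n → (acc.getD i []).length = n

/-- `axpyRows` preserves the shape. -/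
theorem shaped_axpyRows {n : ℕ} (c : ℚ) {acc : List (List ℚ)} (rows : List (List ℚ)) (h : Shaped n acc) : Shaped n (axpyRows c acc rows) := by
  refine ⟨by rw [length_axpyRows, h.1], fun i hi => ?_⟩
  rw [getD_axpyRows c acc rows i (by rw [h.1]; exact hi), length_axpyRow, h.2 i hi]

/-- **Meaning of `axpyRows` as matrices** (for a shaped accumulator). -/
theorem matrixOfRows_axpyRows {n : ℕ} (c : ℚ) {acc : List (List ℚ)} (rows : List (List ℚ)) (h : Shaped n acc) :
    matrixOfRows n n (axpyRows c acc rows) = matrixOfRows n n acc + c • matrixOfRows n n rows := by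
  ext i j
  simp only [matrixOfRows_apply, Matrix.add_apply, Matrix.smul_apply, smul_eq_mul]
  rw [getD_axpyRows c acc rows i.val (by rw [h.1]; exact i.isLt), getD_axpyRow c _ _ j.val (by rw [h.2 i.val i.isLt]; exact j.isLt)]

/-- The zero accumulator `PieceAssembly.zeroRows n = replicate n (replicate n 0)` (shear's landed tooling, reused) is shaped. -/
theorem shaped_zeroRows (n : ℕ) : Shaped n (zeroRows n) := by
  refine ⟨by simp [zeroRows], fun i hi => ?_⟩
  rw [zeroRows, List.getD_replicate _ hi, List.length_replicate]

/-- The assembled rows of a linear combination `Σ c_q · rows_q` (one `axpyRows` pass per piece, from the zero rows). -/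
def lincomb (n : ℕ) (ps : List (ℚ × List (List ℚ))) : List (List ℚ) :=
  ps.foldl (fun acc p => axpyRows p.1 acc p.2) (zeroRows n)

/-- The same linear combination as a matrix. -/
def combSum (n : ℕ) (ps : List (ℚ × List (List ℚ))) : Matrix (Fin n) (Fin n) ℚ :=
  (ps.map fun p => p.1 • matrixOfRows n n p.2).sum

/-- `combSum` of a cons. -/
@[simp] theorem combSum_cons (n : ℕ) (p : ℚ × List (List ℚ)) (ps : List (ℚ × List (List ℚ))) :
    combSum n (p :: ps) = p.1 • matrixOfRows n n p.2 + combSum n ps := by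
  simp [combSum]

/-- `combSum` of nothing. -/
@[simp] theorem combSum_nil (n : ℕ) : combSum n [] = 0 := by simp [combSum]

/-- The fold from any shaped accumulator adds `combSum`. -/
theorem matrixOfRows_foldl {n : ℕ} (ps : List (ℚ × List (List ℚ))) :
    ∀ acc, Shaped n acc → matrixOfRows n n (ps.foldl (fun acc p => axpyRows p.1 acc p.2) acc) = matrixOfRows n n acc + combSum n ps := by
  induction ps with
  | nil => intro acc _; simp
  | cons p ps ih =>
    intro acc h
    rw [List.foldl_cons, ih _ (shaped_axpyRows p.1 p.2 h), matrixOfRows_axpyRows p.1 p.2 h, combSum_cons, add_assoc]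

/-- **The assembled rows ARE the linear combination**: `matrixOfRows n n (lincomb n ps) = Σ c_q • matrixOfRows n n rows_q`. -/
theorem matrixOfRows_lincomb (n : ℕ) (ps : List (ℚ × List (List ℚ))) : matrixOfRows n n (lincomb n ps) = combSum n ps := by
  rw [lincomb, matrixOfRows_foldl ps _ (shaped_zeroRows n), matrixOfRows_zeroRows, zero_add]

end Summit.NavierStokesRegularity.TurbBounds.EvalRows
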